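import Summits.QuantumFields.BalabanUV.Beta.GAN24.DerivativeRateTransferAnalyticMixed
import Mathlib.Analysis.Calculus.MeanValue
import HarnessLib

/-!
# FROM HESSIAN ENTRIES TO H-CLAUSE LETTERS: the real mixed second DIFFERENCE of a bidisc-holomorphic function is bounded by the sup of its
# mixed DERIVATIVE over the real move rectangle — and base-point translation (the organ's size-blind clause holds at every window point)

Cell `ym3-torus` (YM ladder rung R3 = continuum `SU(2)` Yang–Mills on the three-torus — a RUNG, NOT d = 4, NOT infinite volume, NOT a mass
gap, NOT Clay).  LEAD-20520 width seat `ym-ust-20520-w3` (gen 24); `--supports stmt-QuantumFields-20520 --as helper`, count-neutral,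
definition-free, default heartbeats; no registry, binder or `Lines/` edit (registered skeleton `Lines/semiclassical_s2beta.lean` v11.4, 0∕5,
★★OWNER RULING №36, untouched).

WHAT THIS IS.  Companion of ✓-pending `…OrganTangentTwoConstantsMixed` («TopConversion» engine, infinitesimal form: the mixed derivative AT A BASE
POINT is `≲ σ^{(1−r)(1−r′)}`) and ✓-pending `…OrganTangentBidiscMixedDifference` (σ-free letters).  The v18 organ O1ᵘ-H (ideator g26,
`CURRENCY-MEMO-g26.md` §9∕§10; LEAD №15) states its remainder clause in FINITE-DIFFERENCE Hessian currency
`|R Z − R V − R W + R U| ≤ k_{bb′}·(|s|∕θ)·(|t|∕θ)` for REAL one-bond moves of sizes `s, t`.  This file closes the gap between the two shapes: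

* §1 `translate` bookkeeping — `g_(a,b)(s,t) := g(a+s, b+t)` is holomorphic on the bidisc of radius `ρ − δ` when `‖a‖, ‖b‖ ≤ δ`
  (`differentiableOn_translate`), with the same bound (`norm_translate_le`), and its `s`-derivative at `0` is `∂_s g(a, ·)` (`deriv_translate_fst`);
  `differentiableOn_dslice_at` — for REAL `a` with `|a| < ρ`, `t ↦ ∂_s g(a,t)` is holomorphic on a disc (✓`differentiableOn_dslice`, Osgood BY NAME,
  on the translate).
* §2 ★★`norm_mixedDiff_le_of_derivMixed_le` — if `g` is holomorphic on `ball 0 ρ ×ˢ ball 0 ρ` and its mixed derivative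
  `∂_t∂_s g(σ,τ) := deriv (fun t => deriv (fun s => g (s,t)) σ) τ` satisfies `‖∂_t∂_s g(σ,τ)‖ ≤ M` at all REAL `(σ,τ) ∈ [0,s] × [0,t]`
  (`0 ≤ s, t`, `s, t < ρ`), then `‖g(s,t) − g(s,0) − g(0,t) + g(0,0)‖ ≤ M·s·t` — the mean value theorem along the real segment `[0,t]` for the
  holomorphic `τ ↦ ∂_s g(σ,τ)` (§1), then along `[0,s]` for `σ ↦ g(σ,t) − g(σ,0)` (both are ℂ-differentiable; Mathlib's
  `Convex.norm_image_sub_le_of_norm_deriv_le` on the real segment inside ℂ).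
* §3 ★`abs_mixedDiff_le_scaled_of_derivMixed_le` — the same in the H-clause's SCALED shape with window scale `θ`:
  `≤ (M·θ²)·(s∕θ)·(t∕θ)`, real-valued reading included.

So: (β) + the seed's size-blind letter at EVERY window base point ⟹ (by ✓TwoConstantsMixed on each translate) a uniform Hessian-entry bound `M`
on the real square ⟹ (this file) finite-difference H-letters `k := M·θ²`.  WHAT THIS IS NOT: nothing of Bałaban's asserted; O1∕O1ᵘ-H∕S2ᴴ, the
five registered ∘-stubs, crux 20520 `FluctuationComparisonRegPrIntL`, `YM3TorusSU2` NOT proved; no summit is proved by a helper.  R3 = SU(2)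
YM₃ on T³ — NOT d = 4, NOT infinite volume, NOT a mass gap, NOT Clay; the Yang–Mills mass gap is NOT proved.
-/

noncomputable section

open Metric Set Complex
open Summit.QuantumFields.BalabanUV.Beta.GAN24.DerivativeRateTransferAnalyticMixed
  (differentiableOn_slice_fst differentiableOn_slice_snd differentiableOn_dslice isOpen_bidisc)

namespace Summit.QuantumFields.YangMills.Theorems.OrganTangentTopConversionFiniteDifference

variable {g : ℂ × ℂ → ℂ} {ρ : ℝ}

/-! ## §1 Translates and the holomorphy of `t ↦ ∂_s g(a,t)` -/

/-- A disc of radius `ρ − δ` around a point of norm `≤ δ` lies in `ball 0 ρ`. [folklore] -/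
theorem ball_translate_subset {δ : ℝ} {a : ℂ} (ha : ‖a‖ ≤ δ) {z : ℂ} (hz : z ∈ ball (0 : ℂ) (ρ - δ)) :
    a + z ∈ ball (0 : ℂ) ρ := by
  rw [mem_ball, dist_zero_right] at hz ⊢
  calc ‖a + z‖ ≤ ‖a‖ + ‖z‖ := norm_add_le _ _
    _ < δ + (ρ - δ) := add_lt_add_of_le_of_lt ha hz
    _ = ρ := by ring

/-- TRANSLATES ARE HOLOMORPHIC on the shrunk bidisc: `(s,t) ↦ g(a+s, b+t)` on `ball 0 (ρ−δ) ×ˢ ball 0 (ρ−δ)` for `‖a‖, ‖b‖ ≤ δ`. [folklore] -/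
theorem differentiableOn_translate (hg : DifferentiableOn ℂ g (ball (0 : ℂ) ρ ×ˢ ball (0 : ℂ) ρ))
    {δ : ℝ} {a b : ℂ} (ha : ‖a‖ ≤ δ) (hb : ‖b‖ ≤ δ) :
    DifferentiableOn ℂ (fun p : ℂ × ℂ => g (a + p.1, b + p.2)) (ball (0 : ℂ) (ρ - δ) ×ˢ ball (0 : ℂ) (ρ - δ)) := by
  have hT : DifferentiableOn ℂ (fun p : ℂ × ℂ => ((a + p.1, b + p.2) : ℂ × ℂ)) (ball (0 : ℂ) (ρ - δ) ×ˢ ball (0 : ℂ) (ρ - δ)) :=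
    ((differentiableOn_const a).add differentiableOn_fst).prodMk ((differentiableOn_const b).add differentiableOn_snd)
  exact hg.comp hT fun p hp => ⟨ball_translate_subset ha hp.1, ball_translate_subset hb hp.2⟩

/-- Translates keep the bound. [folklore] -/
theorem norm_translate_le {B : ℝ} (hB : ∀ p ∈ ball (0 : ℂ) ρ ×ˢ ball (0 : ℂ) ρ, ‖g p‖ ≤ B)
    {δ : ℝ} {a b : ℂ} (ha : ‖a‖ ≤ δ) (hb : ‖b‖ ≤ δ)
    {q : ℂ × ℂ} (hq : q ∈ ball (0 : ℂ) (ρ - δ) ×ˢ ball (0 : ℂ) (ρ - δ)) : ‖g (a + q.1, b + q.2)‖ ≤ B :=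
  hB _ ⟨ball_translate_subset ha hq.1, ball_translate_subset hb hq.2⟩

/-- The `s`-derivative at `0` of the translate is the `s`-derivative of `g` at `a`. [folklore] -/
theorem deriv_translate_fst (a b t : ℂ) :
    deriv (fun s : ℂ => g (a + s, b + t)) 0 = deriv (fun s : ℂ => g (s, b + t)) a := by
  have h := deriv_comp_const_add (f := fun s : ℂ => g (s, b + t)) a 0
  simpa using h

/-- ★ For REAL `a` with `|a| < ρ`: `t ↦ ∂_s g(a, t)` is holomorphic on `ball 0 (ρ − |a|)` (Osgood BY NAME on the translate `(s,t) ↦ g(a+s, t)`,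
✓`differentiableOn_dslice`). [folklore] -/
theorem differentiableOn_dslice_at (hg : DifferentiableOn ℂ g (ball (0 : ℂ) ρ ×ˢ ball (0 : ℂ) ρ)) {a : ℂ} (ha : ‖a‖ < ρ) :
    DifferentiableOn ℂ (fun t : ℂ => deriv (fun s : ℂ => g (s, t)) a) (ball (0 : ℂ) (ρ - ‖a‖)) := by
  have hρ' : 0 < ρ - ‖a‖ := by linarith
  have hT := differentiableOn_translate hg (δ := ‖a‖) (a := a) (b := 0) le_rfl (by simp)
  have key := differentiableOn_dslice hT hρ'
  refine key.congr fun t _ => ?_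
  have h := deriv_translate_fst (g := g) a 0 t
  simp only [zero_add] at h ⊢
  exact h.symm

/-! ## §2 The finite mixed difference from a mixed-derivative bound on the real rectangle -/

/-- Real points of a real segment `[0, s]` inside ℂ: membership in `segment ℝ 0 ↑s` means `x = ↑σ` with `σ ∈ [0, s]` (`0 ≤ s`). [folklore] -/
theorem exists_real_of_mem_segment {s : ℝ} (hs : 0 ≤ s) {x : ℂ} (hx : x ∈ segment ℝ (0 : ℂ) (s : ℂ)) :
    ∃ σ : ℝ, 0 ≤ σ ∧ σ ≤ s ∧ x = (σ : ℂ) := by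
  rw [segment_eq_image'] at hx
  obtain ⟨θ, hθ, rfl⟩ := hx
  refine ⟨θ * s, mul_nonneg hθ.1 hs, ?_, ?_⟩
  · calc θ * s ≤ 1 * s := by gcongr; exact hθ.2
      _ = s := one_mul s
  · simp [Complex.ofReal_mul, mul_comm]

/-- A real parameter of absolute value `< ρ` is in `ball 0 ρ` as a complex number. [folklore] -/
theorem real_mem_ball' {σ : ℝ} (h : |σ| < ρ) : (σ : ℂ) ∈ ball (0 : ℂ) ρ := by
  rw [mem_ball, dist_zero_right, Complex.norm_real, Real.norm_eq_abs]; exact h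

/-- ★★ **FINITE MIXED DIFFERENCE ≤ (sup of the mixed derivative on the real rectangle) × (area).**  `g : ℂ × ℂ → ℂ` holomorphic on the bidisc
`ball 0 ρ ×ˢ ball 0 ρ`; `0 ≤ s, t`, `s < ρ`, `t < ρ`; if the mixed derivative `∂_t∂_s g(σ,τ) := deriv (fun t => deriv (fun s => g (s,t)) σ) τ`
satisfies `‖∂_t∂_s g(σ,τ)‖ ≤ M` at every REAL `(σ, τ) ∈ [0,s] × [0,t]`, then `‖g(s,t) − g(s,0) − g(0,t) + g(0,0)‖ ≤ M·s·t`.  Proof: for real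
`σ ∈ [0,s]`, `τ ↦ ∂_s g(σ,τ)` is holomorphic on `ball 0 (ρ − σ)` ∋ the segment `[0,t]`… (§1), so `‖∂_s g(σ,t) − ∂_s g(σ,0)‖ ≤ M·t` (mean value);
this is the derivative of the holomorphic `σ ↦ g(σ,t) − g(σ,0)`, whence the claim by the mean value theorem along `[0,s]`.  (The hypothesis
`s + t < ρ` keeps the `τ`-segment inside the disc where §1's holomorphy is stated.) [folklore] -/
theorem norm_mixedDiff_le_of_derivMixed_le (hg : DifferentiableOn ℂ g (ball (0 : ℂ) ρ ×ˢ ball (0 : ℂ) ρ))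
    {s t M : ℝ} (hs : 0 ≤ s) (ht : 0 ≤ t) (hst : s + t < ρ)
    (hM : ∀ σ τ : ℝ, 0 ≤ σ → σ ≤ s → 0 ≤ τ → τ ≤ t →
      ‖deriv (fun t' : ℂ => deriv (fun s' : ℂ => g (s', t')) (σ : ℂ)) (τ : ℂ)‖ ≤ M) :
    ‖g ((s : ℂ), (t : ℂ)) - g ((s : ℂ), 0) - g (0, (t : ℂ)) + g (0, 0)‖ ≤ M * s * t := by
  have hsρ : s < ρ := by linarith
  have htρ : t < ρ := by linarith
  have hM0 : 0 ≤ M := by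
    have := hM 0 0 le_rfl hs le_rfl ht
    exact (norm_nonneg _).trans this
  have htC : (t : ℂ) ∈ ball (0 : ℂ) ρ := real_mem_ball' (by rwa [abs_of_nonneg ht])
  have h0C : (0 : ℂ) ∈ ball (0 : ℂ) ρ := mem_ball_self (by linarith)
  -- Step 1: for real σ ∈ [0,s], the τ-variation of ∂_s g(σ, ·) over [0,t] is ≤ M·t
  have step1 : ∀ σ : ℝ, 0 ≤ σ → σ ≤ s →
      ‖deriv (fun s' : ℂ => g (s', (t : ℂ))) (σ : ℂ) - deriv (fun s' : ℂ => g (s', 0)) (σ : ℂ)‖ ≤ M * t := by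
    intro σ hσ0 hσs
    have hσa : ‖(σ : ℂ)‖ < ρ := by
      rw [Complex.norm_real, Real.norm_eq_abs, abs_of_nonneg hσ0]; linarith
    have hσn : ‖(σ : ℂ)‖ = σ := by rw [Complex.norm_real, Real.norm_eq_abs, abs_of_nonneg hσ0]
    have hD := differentiableOn_dslice_at hg hσa
    -- the segment [0, t] lies in ball 0 (ρ − σ)
    have hseg : ∀ x ∈ segment ℝ (0 : ℂ) (t : ℂ), x ∈ ball (0 : ℂ) (ρ - ‖(σ : ℂ)‖) := by
      intro x hx
      obtain ⟨τ, hτ0, hτt, rfl⟩ := exists_real_of_mem_segment ht hx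
      rw [hσn, mem_ball, dist_zero_right, Complex.norm_real, Real.norm_eq_abs, abs_of_nonneg hτ0]
      linarith
    have hdiff : ∀ x ∈ segment ℝ (0 : ℂ) (t : ℂ), DifferentiableAt ℂ (fun t' : ℂ => deriv (fun s' : ℂ => g (s', t')) (σ : ℂ)) x :=
      fun x hx => hD.differentiableAt (isOpen_ball.mem_nhds (hseg x hx))
    have hbound : ∀ x ∈ segment ℝ (0 : ℂ) (t : ℂ),
        ‖deriv (fun t' : ℂ => deriv (fun s' : ℂ => g (s', t')) (σ : ℂ)) x‖ ≤ M := by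
      intro x hx
      obtain ⟨τ, hτ0, hτt, rfl⟩ := exists_real_of_mem_segment ht hx
      exact hM σ τ hσ0 hσs hτ0 hτt
    have key := (convex_segment (0 : ℂ) (t : ℂ)).norm_image_sub_le_of_norm_deriv_le hdiff hbound
      (left_mem_segment ℝ _ _) (right_mem_segment ℝ _ _)
    have htn : ‖(t : ℂ) - 0‖ = t := by rw [sub_zero, Complex.norm_real, Real.norm_eq_abs, abs_of_nonneg ht]
    rw [htn] at key
    exact key
  -- Step 2: Φ(σ) := g(σ,t) − g(σ,0) is holomorphic on ball 0 ρ with derivative = the difference of Step 1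
  set Φ : ℂ → ℂ := fun σ => g (σ, (t : ℂ)) - g (σ, 0) with hΦ
  have hΦd : DifferentiableOn ℂ Φ (ball (0 : ℂ) ρ) :=
    (differentiableOn_slice_fst hg htC).sub (differentiableOn_slice_fst hg h0C)
  have hΦ' : ∀ x ∈ ball (0 : ℂ) ρ,
      deriv Φ x = deriv (fun s' : ℂ => g (s', (t : ℂ))) x - deriv (fun s' : ℂ => g (s', 0)) x := by
    intro x hx
    have h1 : DifferentiableAt ℂ (fun s' : ℂ => g (s', (t : ℂ))) x :=
      (differentiableOn_slice_fst hg htC).differentiableAt (isOpen_ball.mem_nhds hx)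
    have h2 : DifferentiableAt ℂ (fun s' : ℂ => g (s', 0)) x :=
      (differentiableOn_slice_fst hg h0C).differentiableAt (isOpen_ball.mem_nhds hx)
    exact deriv_sub h1 h2
  have hsegS : ∀ x ∈ segment ℝ (0 : ℂ) (s : ℂ), x ∈ ball (0 : ℂ) ρ := by
    intro x hx
    obtain ⟨σ, hσ0, hσs, rfl⟩ := exists_real_of_mem_segment hs hx
    exact real_mem_ball' (by rw [abs_of_nonneg hσ0]; linarith)
  have hdiffS : ∀ x ∈ segment ℝ (0 : ℂ) (s : ℂ), DifferentiableAt ℂ Φ x :=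
    fun x hx => hΦd.differentiableAt (isOpen_ball.mem_nhds (hsegS x hx))
  have hboundS : ∀ x ∈ segment ℝ (0 : ℂ) (s : ℂ), ‖deriv Φ x‖ ≤ M * t := by
    intro x hx
    obtain ⟨σ, hσ0, hσs, rfl⟩ := exists_real_of_mem_segment hs hx
    rw [hΦ' _ (hsegS _ hx)]
    exact step1 σ hσ0 hσs
  have key := (convex_segment (0 : ℂ) (s : ℂ)).norm_image_sub_le_of_norm_deriv_le hdiffS hboundS
    (left_mem_segment ℝ _ _) (right_mem_segment ℝ _ _)
  have hsn : ‖(s : ℂ) - 0‖ = s := by rw [sub_zero, Complex.norm_real, Real.norm_eq_abs, abs_of_nonneg hs]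
  rw [hsn] at key
  have hrew : Φ (s : ℂ) - Φ 0 = g ((s : ℂ), (t : ℂ)) - g ((s : ℂ), 0) - g (0, (t : ℂ)) + g (0, 0) := by
    simp only [hΦ]; ring
  rw [← hrew]
  calc ‖Φ (s : ℂ) - Φ 0‖ ≤ M * t * s := key
    _ = M * s * t := by ring

/-! ## §3 The scaled (H-clause) shape -/

/-- ★ **H-CLAUSE LETTERS FROM HESSIAN ENTRIES** (window scale `θ > 0`): under §2's hypotheses,
`‖g(s,t) − g(s,0) − g(0,t) + g(0,0)‖ ≤ (M·θ²)·(s∕θ)·(t∕θ)` — TN-SB's finite-difference Hessian currency with `k := M·θ²`. [folklore] -/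
theorem norm_mixedDiff_le_scaled_of_derivMixed_le (hg : DifferentiableOn ℂ g (ball (0 : ℂ) ρ ×ˢ ball (0 : ℂ) ρ))
    {θ s t M : ℝ} (hθ : 0 < θ) (hs : 0 ≤ s) (ht : 0 ≤ t) (hst : s + t < ρ)
    (hM : ∀ σ τ : ℝ, 0 ≤ σ → σ ≤ s → 0 ≤ τ → τ ≤ t →
      ‖deriv (fun t' : ℂ => deriv (fun s' : ℂ => g (s', t')) (σ : ℂ)) (τ : ℂ)‖ ≤ M) :
    ‖g ((s : ℂ), (t : ℂ)) - g ((s : ℂ), 0) - g (0, (t : ℂ)) + g (0, 0)‖ ≤ M * θ ^ 2 * (s / θ) * (t / θ) := by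
  have key := norm_mixedDiff_le_of_derivMixed_le hg hs ht hst hM
  calc ‖g ((s : ℂ), (t : ℂ)) - g ((s : ℂ), 0) - g (0, (t : ℂ)) + g (0, 0)‖ ≤ M * s * t := key
    _ = M * θ ^ 2 * (s / θ) * (t / θ) := by field_simp

/-- ★ REAL-VALUED READING (the predicate (β)'s `g (↑s, ↑t) = ↑(f Z)` at the four corners): `|fZ − fV − fW + fU| ≤ (M·θ²)·(s∕θ)·(t∕θ)`.
[folklore] -/
theorem abs_mixedDiff_le_scaled_of_derivMixed_le (hg : DifferentiableOn ℂ g (ball (0 : ℂ) ρ ×ˢ ball (0 : ℂ) ρ))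
    {θ s t M : ℝ} (hθ : 0 < θ) (hs : 0 ≤ s) (ht : 0 ≤ t) (hst : s + t < ρ)
    (hM : ∀ σ τ : ℝ, 0 ≤ σ → σ ≤ s → 0 ≤ τ → τ ≤ t →
      ‖deriv (fun t' : ℂ => deriv (fun s' : ℂ => g (s', t')) (σ : ℂ)) (τ : ℂ)‖ ≤ M)
    {fZ fV fW fU : ℝ} (hZ : g ((s : ℂ), (t : ℂ)) = fZ) (hV : g ((s : ℂ), 0) = fV) (hW : g (0, (t : ℂ)) = fW) (hU : g (0, 0) = fU) :
    |fZ - fV - fW + fU| ≤ M * θ ^ 2 * (s / θ) * (t / θ) := by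
  have key := norm_mixedDiff_le_scaled_of_derivMixed_le hg hθ hs ht hst hM
  rw [hZ, hV, hW, hU] at key
  have hcast : ((fZ : ℂ) - fV - fW + fU) = ((fZ - fV - fW + fU : ℝ) : ℂ) := by push_cast; ring
  rwa [hcast, Complex.norm_real, Real.norm_eq_abs] at key

end Summit.QuantumFields.YangMills.Theorems.OrganTangentTopConversionFiniteDifference

end
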